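import Summits.QuantumFields.YangMills.Theorems.UnitScaleTiltProp8FlatPortKernelRows
import Summits.QuantumFields.YangMills.Theorems.UnitScaleTiltProp8FlatPortGRowsL0
import Summits.QuantumFields.YangMills.Theorems.UnitScaleTiltProp8FlatPortRowSumL0
import Summits.QuantumFields.YangMills.Theorems.UnitScaleTiltProp8FlatPortProp27PadL0
import Summits.QuantumFields.YangMills.Theorems.UnitScaleTiltProp8FlatOpsFromKernelRows
import Literature.MathematicalPhysics.QuantumFieldTheory.Balaban1983to89.B6Prop26LapKLevelV1L0
import HarnessLib

/-!
# Route `UnitScaleTilt`, crux K1 child «MinimiserStabilityRegPr» (stmt-QuantumFields-19200), v8 pillar **P2 `stub_flatOpsCubeSeq`** — THE PORT BRIDGE, file 9 (ASSEMBLY):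
# **`FlatOpsFromKernelRows.KernelRowsAt` — THE PORT-SHAPED INPUT OF P2 — HOLDS AT EVERY CHARTED FAMILY `domT hN D hk` OF THE d = 3 CARRIER, FOR EVERY ODD `L ≥ 5`,
# EVERY HEIGHT `k = K − n ≥ 1`, WITH CONSTANTS DEPENDING ON `L` ONLY** (lit-balaban's hypothesis-free k-level [Balaban1984PropagatorsII] chain — Cor. 2.8 (2.151)₁,₂
# `cor28_kLevel_H_DH`, Prop. 2.7 (2.149) `prop27_kLevel_unconditional`, Prop. 2.6 (2.136)₁,₂,₄ `prop26_2136_lap_kLevel_unconditional_pad_V1`, Lemma 2.1 `lemma21_torus` — read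
# through files 1–8 of this bridge); hence, by file 1's level-0 chart `domT_tdOfAdmL0`, at EVERY `Adm22` family of the P2 text (unit cubes `Λ₀` allowed) on tori with `≥ 5L`
# big blocks per direction

**LEVEL-0 TWIN** of `UnitScaleTiltProp8FlatPortKernelRows` (GAP LIST v22 (P2-L0)): the same statements for lit-balaban's LEVEL-0-ADMITTING torus families
`B6MultiLevelTorusOperatorL0.TDomains` (blocks of every level `0 ≤ j ≤ k` — the P2 text's `Adm22` families have unit cubes `Λ₀ ≠ ∅` in general), obtained from the
gen-17 file by the dictionary swap `B6GlobalChartV1L0.{blkV1, domT}`, `B6Geom246MultiLevel{Box,Torus}L0`, `B6Ineq2142KLevelV1L0.β`, the `…KLevelV1L0` rows of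
lit-balaban's S-E port, and `UnitScaleTiltProp8FlatPort*L0`; the `D`-free lemmas of the gen-17 file (`kernel_bound_mono`, `theta_budget`, `absorb_budget`, `chart_params`) are reused by name, not restated.  TWO STRENGTHENINGS over the gen-17 statements: (a) the `D.Om 1 = univ` binder is GONE (every `Adm22` family, unit cubes `Λ₀` allowed);
(b) UNIFORMITY IN THE FAMILY MEMBER — the constants are chosen from `L` alone, BEFORE the volume exponent `m` (`∃ consts, ∀ m (hm : 1 ≤ m) n K …`; the gen-17 files
quantified `m` first), as `FlatCubeOpsText.FlatOpsAdmAtMS L …` (`∀ F, F.L = L → …`) requires.  Seat `ym3-torus-p1` gen 18.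

Cell `ym3-torus` (HUMAN RULING D-0037, YM ladder rung R3), seat `ym3-torus-p1` gen 17.  `--supports stmt-QuantumFields-19200 --as helper`; count-neutral; def-free.

WHAT IS PROVED (sorry-free; axioms standard; no definition).
* `hKernelRows_of_rows` — bookkeeping: four row bounds at rates `≥ δ₀` over `d_T + 3` give `HKernelRows … (d_T + 3) w (flatH …) C δ₀`;
* `globalBand_unitWeights` — the band weights `w♯(i) = (c′/L^{j(i)})²·(L^{j(i)})³` lie in `GlobalBand 1 1 c′`;
* thresholds: `ineq_thresholds` (the (2.59)-shape and absorption thresholds met for `R ≥ R₀(L, rates)`);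
* **`kernelRowsAt_domT`** (level-`0` families), **`kernelRowsAt_of_adm22`** (every `Adm22` family, no `Ω₁ = T` binder): for odd `L = ℓ + 1 ≥ 5` and volume exponent `m ≥ 1` THERE ARE `M_h⁰, R₀ : ℕ` and `C ≥ 0`, `δ₀ > 0`, `B₃ > 0`, `C_G ≥ 0` such that for all heights
  `n, K` with `1 ≤ K − n`, `K − n + 1 ≤ m + K`, every torus family `D : TDomains 2 ℓ M_h (K−n) P′ R` charted by `hN` with `M_h = Lᵃ ≥ M_h⁰`, `R ≥ R₀`, `P′ = L·P″`, `P″ ≥ 5`,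
  and every P2 weight family `w`: `KernelRowsAt ⟨ℓ+1, hL, m, hm⟩ n K (domT hN D hk) w C δ₀ B₃ C_G`.
HONEST SCOPE.  (i) the `Ω₁ = T` restriction of the gen-17 file is GONE (lit-balaban's G-F3′-L0 milestone, `B6Cor28EntriesKLevelV1L0` p577377); (ii) `L ≥ 5` (`4 ≤ ℓ`, inherited:
sub-gap L3); (iii) the chart needs `P′ = L·P″`, `P″ ≥ 5` (torus ≥ `5L` big blocks per direction); (iv) constants crude.  With (ii)–(iii) this is the `KernelRowsAt` input of
`FlatOpsFromKernelRows.flatOpsAdmAtMS_of_kernelRows` at those data — NOT yet `FlatOpsAdmAtMS` (which quantifies over ALL admissible families, incl. small tori and `L = 3`).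
NOT a claim about the mass gap.

References: T. Bałaban, CMP **96** (1984) 223–250 [Balaban1984PropagatorsII] Lemma 2.1 p.234, Prop. 2.6 (2.136) p.247, Prop. 2.7 (2.149), Cor. 2.8 (2.150)–(2.151) p.249; CMP **102** (1985)
277–309 [Balaban1985Variational] (46) p.285, (130) p.298, (137)–(140) p.298–299, (157)–(158) p.302, (161)–(163) p.303.
-/

set_option autoImplicit false

noncomputable section

open scoped BigOperators InnerProductSpace

namespace Summit.QuantumFields.YangMills.Theorems.FlatPortKernelRowsL0

open FlatPortKernelRows (kernel_bound_mono theta_budget absorb_budget chart_params)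

open Literature.MathematicalPhysics.QuantumFieldTheory.Balaban1983to89
open Literature.MathematicalPhysics.QuantumFieldTheory.BalabanImbrieJaffe1984to88.BIJ85AxialPropagator411 (BondSpace)
open B6MultiLevelBoxOperator (N0)
open B6MultiLevelTorusOperatorL0 (TDomains)
open B6Geom246MultiLevelBoxL0 (bset)
open B6Geom246MultiLevelTorusL0 (geomT bondT lemma21_torus)
open B6GlobalChartV1 (PV toBox)
open B6GlobalChartV1L0 (blkV1 domT)
open B6Ineq2142KLevelV1L0 (lvl lvl_le β)
open B6Ineq2133TwoScaleV1 (onFun)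
open B6GradLegKLevelV1 (DV)
open B6LapLegKLevelV1 (LapV)
open B6RandomWalk (HasMajorant delta3 delta3_pos)
open B6Lemma21Repaired (Ineq261With Ineq263With)
open B6Ineq261LevelGap (K261 K261_nonneg theta_lt_one_of_log)
open B6Prop26KLevelSkeletonV1L0 (pref)
open B6Prop27KLevelV1L0 (lam)
open B6Cor28KLevelV1 (absorb_threshold two_le_RMh)
open B6QGQCoerciveKLevelV1 (gam0 gam0_pos)
open B6CubeWindowV1 (GlobalBand)
open B6SectAOperatorsV1 (BondIdx QsE dcE dcsE)
open B6SectAVectorModelV1 (GE EE)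
open T3ContinuumYM3Torus (T3Family)
open FlatCubeOpsText (IsLevWeight distBI RowSum162)
open FlatOpsLettersAssembly (flatH)
open FlatOpsHRowsFromKernels (HKernelRows)
open FlatOpsFromKernelRows (KernelRowsAt)
open FlatPortDistanceL0 (distBI_domT_le)
open FlatPortHRows12 (cf_ne_zero)
open FlatPortHRows12L0 (hRows12_of_cor28Shape)
open FlatPortCor28PadL0 (cor28_kLevel_H_DH_pad)
open FlatPortProp27PadL0 (prop27_kLevel_pad)
open FlatPortRowSumL0 (rowSum162_domT)
open FlatPortHRows34L0 (hRow3_of_portShapes hRow4_of_portShapes)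
open FlatPortGRowsL0 (gRows_of_portShapes)
open B6Prop26LapKLevelV1L0 (prop26_2136_lap_kLevel_unconditional_pad_V1)

/-- `1 ≤ 3` (named once; every `domT`/`PV` below carries the same proof term). [folklore] -/
private theorem hd3 : 1 ≤ 2 + 1 := by norm_num

section Carrier

variable (ℓ : ℕ) (hL : Odd (ℓ + 1) ∧ 1 < ℓ + 1) (m : ℕ) (hm : 1 ≤ m) (n K : ℕ)
variable {Mh R : ℕ} {P' : Fin (2 + 1) → ℕ}
variable (hN : ∀ μ, N0 ℓ Mh (K - n) P' μ = (PV 2 ℓ m K hd3 hL).sitesPerDir 0) (D : TDomains 2 ℓ Mh (K - n) P' R) (hk : K - n ≤ m + K)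

/-- **FOUR ROW BOUNDS ⟹ `HKernelRows` OVER `d_T + 3`** with one constant `C` (the max) and one rate `δ₀` (the min): bookkeeping. [cite: Balaban1985Variational, (161) p.303; Balaban1984PropagatorsII, Cor. 2.8 (2.151) p.249] -/
theorem hKernelRows_of_rows {C₁ δ₁ C₃ C₄ r δ₀ C : ℝ} (hδ₀1 : δ₀ ≤ δ₁) (hδ₀r : δ₀ ≤ r) (hC₁ : 0 ≤ C₁) (hC₃ : 0 ≤ C₃) (hC₄ : 0 ≤ C₄)
    (hC1 : C₁ ≤ C) (hC3 : C₃ ≤ C) (hC4 : C₄ ≤ C) (w : ℕ → PBond (PV 2 ℓ m K hd3 hL) 0 → ℝ)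
    (h12 : ∀ (c : BondIdx (B6GlobalChartV1L0.domT hN D hk)) (e : BondIdx (domT hN D hk) → ℝ), e c = 1 → (∀ c', c' ≠ c → e c' = 0) → ∀ b : PBond (PV 2 ℓ m K hd3 hL) 0,
      |flatH (⟨ℓ + 1, hL, m, hm⟩ : T3Family) n K (domT hN D hk) e b| ≤ C₁ * Real.exp (-(δ₁ * (((bondT D).dist (blkV1 hN D b) (β hN D hk c) : ℝ) + 3))) ∧
      ∀ ν : Fin (2 + 1), w 1 b * (((ℓ + 1 : ℕ) : ℝ)) ^ (K - n) *
          |flatH (⟨ℓ + 1, hL, m, hm⟩ : T3Family) n K (domT hN D hk) e ⟨b.src.shift ν, b.dir⟩ - flatH (⟨ℓ + 1, hL, m, hm⟩ : T3Family) n K (domT hN D hk) e b| ≤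
        C₁ * Real.exp (-(δ₁ * (((bondT D).dist (blkV1 hN D b) (β hN D hk c) : ℝ) + 3))))
    (h3 : ∀ (c : BondIdx (domT hN D hk)) (e : BondIdx (domT hN D hk) → ℝ), e c = 1 → (∀ c', c' ≠ c → e c' = 0) → ∀ b : PBond (PV 2 ℓ m K hd3 hL) 0,
      w 3 b * |(dcsE ((((ℓ + 1 : ℕ) : ℝ)) ^ (K - n)) (dcE ((((ℓ + 1 : ℕ) : ℝ)) ^ (K - n))
        (WithLp.toLp 2 (flatH (⟨ℓ + 1, hL, m, hm⟩ : T3Family) n K (domT hN D hk) e)))) b| ≤ C₃ * Real.exp (-(r * (((bondT D).dist (blkV1 hN D b) (β hN D hk c) : ℝ) + 3))))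
    (h4 : ∀ (c : BondIdx (domT hN D hk)) (e : BondIdx (domT hN D hk) → ℝ), e c = 1 → (∀ c', c' ≠ c → e c' = 0) → ∀ b : PBond (PV 2 ℓ m K hd3 hL) 0,
      w 2 b * (((((ℓ + 1 : ℕ) : ℝ)) ^ (K - n)) ^ 2) *
        |∑ ν : Fin (2 + 1), ((flatH (⟨ℓ + 1, hL, m, hm⟩ : T3Family) n K (domT hN D hk) e b - flatH (⟨ℓ + 1, hL, m, hm⟩ : T3Family) n K (domT hN D hk) e ⟨b.src.shift ν, b.dir⟩) +
            (flatH (⟨ℓ + 1, hL, m, hm⟩ : T3Family) n K (domT hN D hk) e b - flatH (⟨ℓ + 1, hL, m, hm⟩ : T3Family) n K (domT hN D hk) e ⟨b.src.unshift ν, b.dir⟩))| ≤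
        C₄ * Real.exp (-(r * (((bondT D).dist (blkV1 hN D b) (β hN D hk c) : ℝ) + 3)))) :
    HKernelRows (⟨ℓ + 1, hL, m, hm⟩ : T3Family) n K (domT hN D hk) (fun b c => ((bondT D).dist (blkV1 hN D b) (β hN D hk c) : ℝ) + 3) w
      (flatH (⟨ℓ + 1, hL, m, hm⟩ : T3Family) n K (domT hN D hk)) C δ₀ := by
  intro c e he he' b
  have ht : 0 ≤ ((bondT D).dist (blkV1 hN D b) (β hN D hk c) : ℝ) + 3 := by positivity
  obtain ⟨h1, h2⟩ := h12 c e he he' b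
  refine ⟨h1.trans (kernel_bound_mono hC1 hC₁ hδ₀1 ht), fun ν => (h2 ν).trans (kernel_bound_mono hC1 hC₁ hδ₀1 ht),
    (h3 c e he he' b).trans (kernel_bound_mono hC3 hC₃ hδ₀r ht), (h4 c e he he' b).trans (kernel_bound_mono hC4 hC₄ hδ₀r ht)⟩

/-- **THE BAND WEIGHTS** `w♯(i) = (c′/L^{j(i)})²·(L^{j(i)})³` lie in `GlobalBand 1 1 c′` (print's (2.16) weights `a_j(Lʲη)^{−2}` up to the `(2.150)` volume, in the units `c′`).
[cite: Balaban1984PropagatorsII, (2.16) p.225, (2.90) p.239] -/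
theorem globalBand_unitWeights :
    GlobalBand (Dm := B6GlobalChartV1L0.domT hN D hk) 1 1 ((((ℓ + 1 : ℕ) : ℝ)) ^ (K - n))
      (fun i : BondIdx (domT hN D hk) => ((((ℓ + 1 : ℕ) : ℝ)) ^ (K - n) / (((ℓ + 1 : ℕ) : ℝ)) ^ (i.1.1 : ℕ)) ^ 2 * ((((ℓ + 1 : ℕ) : ℝ)) ^ (i.1.1 : ℕ)) ^ (2 + 1)) := by
  intro i
  have hL0 : (0 : ℝ) < ((ℓ + 1 : ℕ) : ℝ) := by exact_mod_cast Nat.succ_pos ℓ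
  have hq : ((((ℓ + 1 : ℕ) : ℝ)) ^ (K - n) / (((ℓ + 1 : ℕ) : ℝ)) ^ (i.1.1 : ℕ)) ^ 2 ≠ 0 := by positivity
  have hkey : ((((ℓ + 1 : ℕ) : ℝ)) ^ (K - n) / (((ℓ + 1 : ℕ) : ℝ)) ^ (i.1.1 : ℕ)) ^ 2 * ((((ℓ + 1 : ℕ) : ℝ)) ^ (i.1.1 : ℕ)) ^ (2 + 1) /
      ((((ℓ + 1 : ℕ) : ℝ)) ^ (K - n) / (((ℓ + 1 : ℕ) : ℝ)) ^ (i.1.1 : ℕ)) ^ 2 = ((((ℓ + 1 : ℕ) : ℝ)) ^ (i.1.1 : ℕ)) ^ (2 + 1) :=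
    mul_div_cancel_left₀ _ hq
  show 1 * ((((ℓ + 1 : ℕ) : ℝ)) ^ (i.1.1 : ℕ)) ^ (2 + 1) ≤
      ((((ℓ + 1 : ℕ) : ℝ)) ^ (K - n) / (((ℓ + 1 : ℕ) : ℝ)) ^ (i.1.1 : ℕ)) ^ 2 * ((((ℓ + 1 : ℕ) : ℝ)) ^ (i.1.1 : ℕ)) ^ (2 + 1) /
        ((((ℓ + 1 : ℕ) : ℝ)) ^ (K - n) / (((ℓ + 1 : ℕ) : ℝ)) ^ (i.1.1 : ℕ)) ^ 2 ∧
    ((((ℓ + 1 : ℕ) : ℝ)) ^ (K - n) / (((ℓ + 1 : ℕ) : ℝ)) ^ (i.1.1 : ℕ)) ^ 2 * ((((ℓ + 1 : ℕ) : ℝ)) ^ (i.1.1 : ℕ)) ^ (2 + 1) /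
        ((((ℓ + 1 : ℕ) : ℝ)) ^ (K - n) / (((ℓ + 1 : ℕ) : ℝ)) ^ (i.1.1 : ℕ)) ^ 2 ≤ 1 * ((((ℓ + 1 : ℕ) : ℝ)) ^ (i.1.1 : ℕ)) ^ (2 + 1)
  rw [hkey, one_mul]
  exact ⟨le_rfl, le_rfl⟩

/-- the band weights are positive. [cite: Balaban1984PropagatorsII, (2.16) p.225, bookkeeping] -/
theorem unitWeights_pos (i : BondIdx (B6GlobalChartV1L0.domT hN D hk)) :
    0 < ((((ℓ + 1 : ℕ) : ℝ)) ^ (K - n) / (((ℓ + 1 : ℕ) : ℝ)) ^ (i.1.1 : ℕ)) ^ 2 * ((((ℓ + 1 : ℕ) : ℝ)) ^ (i.1.1 : ℕ)) ^ (2 + 1) := by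
  have hL0 : (0 : ℝ) < ((ℓ + 1 : ℕ) : ℝ) := by exact_mod_cast Nat.succ_pos ℓ
  positivity

end Carrier

/-! ## The thresholds («R M sufficiently large», (163), (2.59)) -/

/-! ## The assembly -/

/-- **`KernelRowsAt` AT EVERY CHARTED FAMILY OF THE d = 3 CARRIER, ODD `L ≥ 5`, `k ≥ 1`** — the port-shaped input of P2 (`FlatOpsFromKernelRows.flatOpsAdmAtMS_of_kernelRows`)
from lit-balaban's hypothesis-free k-level [B6] chain read through files 1–8: there are `M_h⁰, R₀` and constants `C ≥ 0`, `δ₀ > 0`, `B₃ > 0`, `C_G ≥ 0` (functions of `L` only)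
such that for every height, every torus family with `M_h = Lᵃ ≥ M_h⁰`, `R ≥ R₀`, `P′ = L·P″`, `P″ ≥ 5` and every P2 weight family, `KernelRowsAt F n K (domT hN D hk) w C δ₀ B₃ C_G`.
[cite: Balaban1984PropagatorsII, Cor. 2.8 (2.150)-(2.151) p.249, Prop. 2.7 (2.149) p.249, Prop. 2.6 (2.136) p.247, Lemma 2.1 p.234; Balaban1985Variational, (161)-(163) p.303, (130) p.298, (137)-(140) p.298-299] -/
theorem kernelRowsAt_domT (ℓ : ℕ) (hL : Odd (ℓ + 1) ∧ 1 < ℓ + 1) (hℓ : 4 ≤ ℓ) :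
    ∃ (Mh₀ R₀ : ℕ) (C δ₀ B₃ CG : ℝ), 0 ≤ C ∧ 0 < δ₀ ∧ 0 < B₃ ∧ 0 ≤ CG ∧
    ∀ (m : ℕ) (hm : 1 ≤ m) (n K : ℕ) {Mh R : ℕ} {P' : Fin (2 + 1) → ℕ} (hN : ∀ μ, N0 ℓ Mh (K - n) P' μ = (PV 2 ℓ m K hd3 hL).sitesPerDir 0)
      (D : TDomains 2 ℓ Mh (K - n) P' R) (hk : K - n ≤ m + K) (_ : 1 ≤ K - n) (_ : K - n + 1 ≤ m + K)
      {P'' : Fin (2 + 1) → ℕ} (_ : ∀ μ, P' μ = (ℓ + 1) * P'' μ) (_ : ∀ μ, 5 ≤ P'' μ)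
      {a : ℕ} (_ : Mh = (ℓ + 1) ^ a) (_ : Mh₀ ≤ Mh) (_ : R₀ ≤ R)
      (w : ℕ → PBond (PV 2 ℓ m K hd3 hL) 0 → ℝ) (_ : IsLevWeight (⟨ℓ + 1, hL, m, hm⟩ : T3Family) n K (B6GlobalChartV1L0.domT hN D hk) w),
      KernelRowsAt (⟨ℓ + 1, hL, m, hm⟩ : T3Family) n K (domT hN D hk) w C δ₀ B₃ CG := by
  -- the three port packages at the unit band `b₀ = b₁ = 1`
  obtain ⟨σa, hσa, hA⟩ := cor28_kLevel_H_DH_pad 2 ℓ hd3 hL one_pos (le_refl (1 : ℝ))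
  obtain ⟨σb, hσb, hB⟩ := prop27_kLevel_pad 2 ℓ hd3 hL one_pos (le_refl (1 : ℝ))
  obtain ⟨σc, hσc, hC⟩ := prop26_2136_lap_kLevel_unconditional_pad_V1 2 ℓ hd3 hL one_pos (le_refl (1 : ℝ))
  set σ : ℝ := min σa (min σb σc) with hσ
  have hσ0 : 0 < σ := lt_min hσa (lt_min hσb hσc)
  have hσa' : σ ≤ σa := min_le_left _ _
  have hσb' : σ ≤ σb := (min_le_right _ _).trans (min_le_left _ _)
  have hσc' : σ ≤ σc := (min_le_right _ _).trans (min_le_right _ _)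
  obtain ⟨δ₅, C₅, M₂a, N₁a, hδ₅, hC₅, hM₂a, hrowsA⟩ := hA σ hσ0 hσa' (1 / 2) (by norm_num) (by norm_num)
  obtain ⟨A', M₂b, cc, N₁b, hA', hM₂b, hcc, hrowsB⟩ := hB σ hσ0 hσb' (1 / 2) (by norm_num) (by norm_num)
  obtain ⟨A, M₂c, hA0, hM₂c, hrowsC⟩ := hC σ hσ0 hσc' (1 / 2) (by norm_num) (by norm_num)
  -- the rates
  set δ₃ : ℝ := delta3 (1 / 2) (2 * σ) with hδ₃
  have hδ₃0 : 0 < δ₃ := delta3_pos (by norm_num) (by linarith)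
  set γ₀ : ℝ := gam0 2 ℓ 1 with hγ₀
  have hγ₀0 : 0 < γ₀ := gam0_pos 2 ℓ zero_le_one
  set δ₄ : ℝ := min (δ₃ / 4) (γ₀ / A' / (2 * (1 * (4 / δ₃) * (2 * ((2 : ℝ) + 1) * cc)) + 1)) with hδ₄
  have hδ₄0 : 0 < δ₄ := by
    refine lt_min (by linarith) (div_pos (div_pos hγ₀0 hA') ?_)
    have : 0 ≤ 2 * (1 * (4 / δ₃) * (2 * ((2 : ℝ) + 1) * cc)) := by positivity
    linarith
  have hδ₄3 : δ₄ ≤ δ₃ := (min_le_left _ _).trans (by linarith)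
  set r : ℝ := (1 - 1 / 16) * (δ₄ / 2) with hr
  have hr0 : 0 < r := by rw [hr]; positivity
  set δ₀ : ℝ := min δ₅ r with hδ₀
  have hδ₀0 : 0 < δ₀ := lt_min hδ₅ hr0
  have hδ₀5 : δ₀ ≤ δ₅ := min_le_left _ _
  have hδ₀r : δ₀ ≤ r := min_le_right _ _
  -- Lemma-2.1 budgets: (2.63) at rate `δ₄/2`, `α′ = 1/16`; (2.61) at rate `δ₀/4` (row sum) and `δ₃/2` (G rows)
  obtain ⟨hN63pos, hθ63⟩ := theta_budget ℓ (show 0 < 1 / 16 * (δ₄ / 2) by positivity)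
  obtain ⟨hN0pos, hθ0⟩ := theta_budget ℓ (show 0 < 1 / 4 * δ₀ by positivity)
  obtain ⟨hNgpos, hθg⟩ := theta_budget ℓ (show 0 < 1 / 2 * δ₃ by positivity)
  set N63 : ℕ := ⌈2 * ((2 + 1 : ℕ) : ℝ) * Real.log ((ℓ : ℝ) + 1) / (1 / 16 * (δ₄ / 2))⌉₊ + 1 with hN63
  set N0 : ℕ := ⌈2 * ((2 + 1 : ℕ) : ℝ) * Real.log ((ℓ : ℝ) + 1) / (1 / 4 * δ₀)⌉₊ + 1 with hN0
  set Ng : ℕ := ⌈2 * ((2 + 1 : ℕ) : ℝ) * Real.log ((ℓ : ℝ) + 1) / (1 / 2 * δ₃)⌉₊ + 1 with hNg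
  set Na4 : ℕ := ⌈2 * ((2 : ℝ) + 3) * ((ℓ : ℝ) + 1) / δ₄⌉₊ with hNa4
  set Na0 : ℕ := ⌈2 * ((2 : ℝ) + 3) * ((ℓ : ℝ) + 1) / (δ₀ / 4)⌉₊ with hNa0
  set Nag : ℕ := ⌈2 * ((2 : ℝ) + 3) * ((ℓ : ℝ) + 1) / δ₃⌉₊ with hNag
  -- the constants
  set Lr : ℝ := (ℓ : ℝ) + 1 with hLr
  have hL1 : (1 : ℝ) ≤ Lr := by rw [hLr]; linarith [(Nat.cast_nonneg ℓ : (0 : ℝ) ≤ ℓ)]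
  set c63 : ℝ := K261 N63 (2 + 1) Lr 1 (1 / 16 * (δ₄ / 2)) with hc63
  set K₃ : ℝ := (2 / γ₀) * (2 * (((ℓ + 1 : ℕ) : ℝ)) ^ (2 + 1) * Real.exp (δ₃ * ((ℓ : ℝ) + 3))) * Lr ^ 2 * Lr ^ (2 + 3) * (2 * ((2 : ℝ) + 1)) * c63 ^ 2 with hK₃
  have hK₃0 : 0 ≤ K₃ := by
    have := K261_nonneg (N := N63) (dd := 2 + 1) (σ := 1 / 16 * (δ₄ / 2)) (by linarith : (0 : ℝ) ≤ Lr) zero_le_one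
    rw [hK₃]; positivity
  set C₁ : ℝ := C₅ * Real.exp (3 * δ₅) with hC₁
  set C₃ : ℝ := K₃ * Real.exp (3 * r) + 1 * Real.exp (r * ((ℓ : ℝ) + 6)) with hC₃
  set C₄ : ℝ := A * (K₃ * Real.exp (3 * r)) with hC₄
  have hC₁0 : 0 ≤ C₁ := by positivity
  have hC₃0 : 0 ≤ C₃ := by positivity
  have hC₄0 : 0 ≤ C₄ := by positivity
  set Cbig : ℝ := max C₁ (max C₃ C₄) with hCbig
  set c1g : ℝ := K261 Ng (2 + 1) Lr 1 (1 / 2 * δ₃) with hc1g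
  have hc1g0 : 0 ≤ c1g := K261_nonneg (by linarith : (0 : ℝ) ≤ Lr) zero_le_one
  set B₃ : ℝ := 6 * Lr * (1 / (Real.exp 1 * (δ₀ / 8)) + 4) * K261 N0 (2 + 1) Lr 1 (1 / 4 * δ₀) with hB₃
  have hB₃0 : 0 ≤ B₃ := by
    have := K261_nonneg (N := N0) (dd := 2 + 1) (σ := 1 / 4 * δ₀) (by linarith : (0 : ℝ) ≤ Lr) zero_le_one
    have := Real.exp_pos 1
    rw [hB₃]; positivity
  -- the thresholds on `M_h` and `R`
  set Mh₀ : ℕ := max 8 (max ⌈M₂a⌉₊ (max ⌈M₂b⌉₊ ⌈M₂c⌉₊)) with hMh₀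
  set R₀ : ℕ := max (2 * (ℓ + 1) ^ 2) (max (N₁a + 1) (max (N₁b + 1) (max (N63 + 1) (max (N0 + 1) (max (Ng + 1) (max (Na4 + 1) (max (Na0 + 1) (Nag + 1)))))))) with hR₀
  refine ⟨Mh₀, R₀, Cbig, δ₀, B₃ + 1, A * Lr ^ 3 * c1g, hC₁0.trans (le_max_left _ _), hδ₀0, by linarith, by positivity, ?_⟩
  intro m hm n K Mh R P' hN D hk hk1 hk' P'' hLP hP5 a hMha hMh hR w hw
  -- unpack the thresholds
  have hM8 : 8 ≤ Mh := le_trans (le_max_left _ _) hMh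
  have hMh1 : 1 ≤ Mh := le_trans (by norm_num) hM8
  have hR2 : 2 * (ℓ + 1) ^ 2 ≤ R := le_trans (le_max_left _ _) hR
  have hRMh : 2 ≤ R * Mh := two_le_RMh hR2 hM8
  have hRLM : ∀ {N : ℕ}, N + 1 ≤ R₀ → N + 1 ≤ R * ((ℓ + 1) * Mh) := fun {N} h =>
    le_trans (le_trans h hR) (Nat.le_mul_of_pos_right R (Nat.mul_pos (Nat.succ_pos ℓ) (by omega)))
  have hN₁a : N₁a + 1 ≤ R * ((ℓ + 1) * Mh) := hRLM (le_trans (le_max_left _ _) (le_max_right _ _))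
  have hN₁b : N₁b + 1 ≤ R * ((ℓ + 1) * Mh) := hRLM (le_trans (le_trans (le_max_left _ _) (le_max_right _ _)) (le_max_right _ _))
  have hN63' : N63 + 1 ≤ R * ((ℓ + 1) * Mh) :=
    hRLM (le_trans (le_trans (le_trans (le_max_left _ _) (le_max_right _ _)) (le_max_right _ _)) (le_max_right _ _))
  have hN0' : N0 + 1 ≤ R * ((ℓ + 1) * Mh) :=
    hRLM (le_trans (le_trans (le_trans (le_trans (le_max_left _ _) (le_max_right _ _)) (le_max_right _ _)) (le_max_right _ _)) (le_max_right _ _))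
  have hNg' : Ng + 1 ≤ R * ((ℓ + 1) * Mh) :=
    hRLM (le_trans (le_trans (le_trans (le_trans (le_trans (le_max_left _ _) (le_max_right _ _)) (le_max_right _ _)) (le_max_right _ _)) (le_max_right _ _)) (le_max_right _ _))
  have hNa4' : Na4 + 1 ≤ R * ((ℓ + 1) * Mh) :=
    hRLM (le_trans (le_trans (le_trans (le_trans (le_trans (le_trans (le_max_left _ _) (le_max_right _ _)) (le_max_right _ _)) (le_max_right _ _)) (le_max_right _ _))
      (le_max_right _ _)) (le_max_right _ _))
  have hNa0' : Na0 + 1 ≤ R * ((ℓ + 1) * Mh) :=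
    hRLM (le_trans (le_trans (le_trans (le_trans (le_trans (le_trans (le_trans (le_max_left _ _) (le_max_right _ _)) (le_max_right _ _)) (le_max_right _ _))
      (le_max_right _ _)) (le_max_right _ _)) (le_max_right _ _)) (le_max_right _ _))
  have hNag' : Nag + 1 ≤ R * ((ℓ + 1) * Mh) :=
    hRLM (le_trans (le_trans (le_trans (le_trans (le_trans (le_trans (le_trans (le_max_right _ _) (le_max_right _ _)) (le_max_right _ _)) (le_max_right _ _))
      (le_max_right _ _)) (le_max_right _ _)) (le_max_right _ _)) (le_max_right _ _))
  have hRM1 : 1 ≤ R * ((ℓ + 1) * Mh) := le_trans (by omega) hN0'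
  have hMreal : ∀ {M₂ : ℝ}, ⌈M₂⌉₊ ≤ Mh → M₂ ≤ ((ℓ : ℝ) + 1) * Mh := fun {M₂} h => by
    have h1 : M₂ ≤ (⌈M₂⌉₊ : ℝ) := Nat.le_ceil _
    have h2 : (⌈M₂⌉₊ : ℝ) ≤ (Mh : ℝ) := by exact_mod_cast h
    have h3 : (Mh : ℝ) ≤ ((ℓ : ℝ) + 1) * Mh := le_mul_of_one_le_left (Nat.cast_nonneg _) hL1
    linarith
  have hM₂a' : M₂a ≤ ((ℓ : ℝ) + 1) * Mh := hMreal (le_trans (le_trans (le_max_left _ _) (le_max_right _ _)) hMh)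
  have hM₂b' : M₂b ≤ ((ℓ : ℝ) + 1) * Mh := hMreal (le_trans (le_trans (le_trans (le_max_left _ _) (le_max_right _ _)) (le_max_right _ _)) hMh)
  have hM₂c' : M₂c ≤ ((ℓ : ℝ) + 1) * Mh := hMreal (le_trans (le_trans (le_trans (le_max_right _ _) (le_max_right _ _)) (le_max_right _ _)) hMh)
  have hP1 : ∀ μ, 1 ≤ P' μ := fun μ => by rw [hLP μ]; exact Nat.mul_pos (Nat.succ_pos ℓ) (by have := hP5 μ; omega)
  have hP5L : ∀ μ, 5 * (ℓ + 1) ≤ P' μ := fun μ => by rw [hLP μ, mul_comm]; exact Nat.mul_le_mul_left _ (hP5 μ)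
  -- the band weights
  set ws : BondIdx (domT hN D hk) → ℝ := fun i =>
    ((((ℓ + 1 : ℕ) : ℝ)) ^ (K - n) / (((ℓ + 1 : ℕ) : ℝ)) ^ (i.1.1 : ℕ)) ^ 2 * ((((ℓ + 1 : ℕ) : ℝ)) ^ (i.1.1 : ℕ)) ^ (2 + 1) with hws_def
  have hws : ∀ i, 0 < ws i := unitWeights_pos ℓ hL m n K hN D hk
  have hband : GlobalBand (Dm := domT hN D hk) 1 1 ((((ℓ + 1 : ℕ) : ℝ)) ^ (K - n)) ws := globalBand_unitWeights ℓ hL m n K hN D hk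
  -- the port rows at these data
  obtain ⟨hH1, hH2⟩ := hrowsA m K hN D hk hk1 hk' hLP hP5 hMha hM8 hR2 hℓ hM₂a' hN₁a (cf_ne_zero ℓ n K) hws hband
  have h2149 := hrowsB m K hN D hk hk1 hk' hLP hP5 hMha hM8 hR2 hℓ hM₂b' hN₁b (cf_ne_zero ℓ n K) hws hband
  obtain ⟨hGm, hDGm, hLapm⟩ := hrowsC m K hN D hk hk1 hMha hM8 hR2 hP5L hℓ hM₂c' (cf_ne_zero ℓ n K) hws hband
  -- Lemma 2.1 on the torus at the three rates
  obtain ⟨-, -, -, h263⟩ := lemma21_torus (D := D) hMh1 hP1 hN63pos hN63' (show (0 : ℝ) ≤ δ₄ / 2 by positivity)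
    (by norm_num : (0 : ℝ) ≤ 1 / 16) (by norm_num : (1 : ℝ) / 16 ≤ 1) hθ63
  obtain ⟨-, h261g, -, -⟩ := lemma21_torus (D := D) hMh1 hP1 hNgpos hNg' hδ₃0.le (by norm_num : (0 : ℝ) ≤ 1 / 2) (by norm_num : (1 : ℝ) / 2 ≤ 1) hθg
  -- absorption thresholds
  obtain ⟨hsm4, -, -⟩ := absorb_budget ℓ hδ₄0 hNa4'
  obtain ⟨-, -, hsm0⟩ := absorb_budget ℓ (show 0 < δ₀ / 4 by positivity) hNa0'
  obtain ⟨-, hsmg, -⟩ := absorb_budget ℓ hδ₃0 hNag'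
  have hsm0' : ((ℓ : ℝ) + 1) ^ 1 * Real.exp (-(δ₀ / 8 * ((R : ℝ) * (((ℓ : ℝ) + 1) * Mh) - 1))) ≤ 1 := by
    have e : δ₀ / 4 / 2 = δ₀ / 8 := by ring
    rw [e] at hsm0; exact hsm0
  refine ⟨⟨fun b c => ((bondT D).dist (blkV1 hN D b) (β hN D hk c) : ℝ) + 3, fun b c => distBI_domT_le hN D hk hMh1 hP1 b c, ?_, ?_⟩, ?_⟩
  · -- (162)
    intro b
    have h := rowSum162_domT ℓ hL m hm n K hN D hk hMh1 hP1 hδ₀0 hN0pos hN0' hθ0 hsm0' w hw b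
    exact h.trans (by linarith)
  · -- the four kernel rows
    refine hKernelRows_of_rows ℓ hL m hm n K hN D hk (C := Cbig) hδ₀5 hδ₀r hC₁0 hC₃0 hC₄0 (le_max_left _ _)
      ((le_max_left _ _).trans (le_max_right _ _)) ((le_max_right _ _).trans (le_max_right _ _)) w ?_ ?_ ?_
    · intro c e he he' b
      exact hRows12_of_cor28Shape ℓ hL m hm n K hN D hk hws hH1 hH2 w hw c e he he' b
    · intro c e he he' b
      exact hRow3_of_portShapes ℓ hL m hm n K hN D hk hRMh hMh1 hP1 hws zero_le_one hband (by positivity) hδ₄0 hδ₄3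
        (by norm_num : (1 : ℝ) / 16 ≤ 1) h2149 hsm4 h263 w hw c e he he' b
    · intro c e he he' b
      exact hRow4_of_portShapes ℓ hL m hm n K hN D hk hRMh hMh1 hP1 hws hA0 (by positivity) hδ₄0 hδ₄3 hLapm h2149 hsm4 h263 w hw c e he he' b
  · -- the G rows
    obtain ⟨hflat, hsup, hlap⟩ := gRows_of_portShapes ℓ hL m hm n K hN D hk hMh1 hP1 hRM1 hws hA0 hδ₃0.le hGm hDGm hLapm hsmg h261g w hw
    exact ⟨ws, hws, _, hflat, hsup, hlap⟩

/-! ## The P2 text's own families: every `Adm22` family (file 1's level-0 chart `FlatPortChartL0`) -/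

/-- **`KernelRowsAt` AT EVERY ADMISSIBLE FAMILY OF THE P2 TEXT — NO `Ω₁ = T` HYPOTHESIS** (level `0` admitted; via `FlatPortChartL0.tdOfAdmL0`/`domT_tdOfAdmL0`): for odd `L = ℓ + 1 ≥ 5`, `m ≥ 1` there are `M_h⁰, R₀` and
`C ≥ 0`, `δ₀ > 0`, `B₃ > 0`, `C_G ≥ 0` such that for all heights `1 ≤ K − n`, `K − n + 1 ≤ m + K`, big blocks `M = L·M_h`, `M_h = L^{a′} ≥ M_h⁰`, `R ≥ R₀`, torus size
`a′ + 3 ≤ m + n`, every `D : Domains (F.P K)` with `D.k = K − n`, `Adm22 D R (L·M_h)` (unit cubes `Λ₀` allowed), and every P2 weight family: `KernelRowsAt F n K D w C δ₀ B₃ C_G`.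
[cite: Balaban1984PropagatorsII, (2.1)-(2.4) p.224, Cor. 2.8 (2.150)-(2.151) p.249; Balaban1985Variational, (161)-(163) p.303] -/
theorem kernelRowsAt_of_adm22 (ℓ : ℕ) (hL : Odd (ℓ + 1) ∧ 1 < ℓ + 1) (hℓ : 4 ≤ ℓ) :
    ∃ (Mh₀ R₀ : ℕ) (C δ₀ B₃ CG : ℝ), 0 ≤ C ∧ 0 < δ₀ ∧ 0 < B₃ ∧ 0 ≤ CG ∧
    ∀ (m : ℕ) (hm : 1 ≤ m) (n K : ℕ) (_ : 1 ≤ K - n) (_ : K - n + 1 ≤ m + K) {Mh R a' : ℕ} (_ : Mh = (ℓ + 1) ^ a') (_ : Mh₀ ≤ Mh) (_ : R₀ ≤ R) (_ : a' + 3 ≤ m + n)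
      (D : B6SectADomainsV1.Domains (PV 2 ℓ m K hd3 hL)) (hDk : D.k = K - n) (_ : FlatCubeOpsText.Adm22 D R ((ℓ + 1) * Mh))
      (w : ℕ → PBond (PV 2 ℓ m K hd3 hL) 0 → ℝ) (_ : IsLevWeight (⟨ℓ + 1, hL, m, hm⟩ : T3Family) n K D w),
      KernelRowsAt (⟨ℓ + 1, hL, m, hm⟩ : T3Family) n K D w C δ₀ B₃ CG := by
  obtain ⟨Mh₀, R₀, C, δ₀, B₃, CG, hC, hδ₀, hB₃, hCG, hmain⟩ := kernelRowsAt_domT ℓ hL hℓ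
  refine ⟨Mh₀, R₀, C, δ₀, B₃, CG, hC, hδ₀, hB₃, hCG, ?_⟩
  intro m hm n K hk1 hk' Mh R a' hMha hMh hR hsize D hDk hAdm w hw
  have hk : K - n ≤ m + K := by omega
  obtain ⟨hN, hLP, hP5⟩ := chart_params ℓ m n K a' hL hℓ hk1 hsize
  rw [hMha] at hAdm
  have hN' : ∀ μ : Fin (2 + 1), N0 ℓ Mh (K - n) (fun _ => 2 * (ℓ + 1) ^ (m + n - 1 - a')) μ = (PV 2 ℓ m K hd3 hL).sitesPerDir 0 := by
    rw [hMha]; exact hN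
  rw [← hMha] at hAdm
  set D' := FlatPortChartL0.tdOfAdmL0 hN' D hDk hk hAdm with hD'
  have hEq : domT hN' D' hk = D := FlatPortChartL0.domT_tdOfAdmL0 hN' D hDk hk hAdm
  rw [← hEq] at hw ⊢
  exact hmain m hm n K hN' D' hk hk1 hk' hLP hP5 hMha hMh hR w hw

end Summit.QuantumFields.YangMills.Theorems.FlatPortKernelRowsL0

end
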